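import Summits.BirchSwinnertonDyer.BirchSwinnertonDyer.Theses.ShaPrimaryTransfer
import Literature.NumberTheory.EllipticCurves.XCubeSub81675ShaThree

/-!
# BirchSwinnertonDyer / ShaPrimaryTransfer — crux `FiniteShaComponentTransfer` (stmt-BirchSwinnertonDyer-22356):
# THE DOOR AT 3 is open in the kernel at RANK 2 — `t_3 = 0`, `corank Sel_{3^∞} = rank = 2` for `y² = x³ − 27·55²`,
# by a complete `3`-descent (no `2`-descent, no `L`-function, no Iwasawa theory)

Route `ShaPrimaryTransfer` (D-0145 LINE 2): T = `FiniteShaComponentTransfer` (stmt-22356: «`t_p(E) = 0 ⟹ t_q(E) = 0`»,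
`t_p(E) = corank_{ℤ_p} Ш(E)[p^∞]`), O = `OneFiniteShaComponent` (stmt-22357: «some prime `p₀` — 2 AND 3 allowed — with
`t_{p₀}(E) = 0`», decided curve by curve by `p₀`-descent). Every door certified in the tree so far (g0–g5: 37 helper files)
was a door at `p₀ = 2` (complete `2`-descent / `2`-isogeny descent). This helper file (prover seat `bsd-line-spt-p1` g6,
`--supports stmt-22356 --as helper`) records the FIRST DOOR AT `p₀ = 3`, at rank `2`, UNCONDITIONALLY (standard axioms,
no named fact):

  `A : y² = x³ − 81675 = x³ − 27·55²` (the `3`-isogenous partner / `−3`-twist of `y² = x³ + 55²`; Jeong 2019, family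
  `A_{pq}`, `p = 5`, `q = 11`): **`rank A(ℚ) = 2`, `Ш(A/ℚ)[3^∞] = 0`, `t_3(A) = 0`, `corank_{ℤ₃} Sel_{3^∞}(A/ℚ) = 2`**.

The proof (tree, `Literature/NumberTheory/EllipticCurves/XCubeSub81675{ThreeDescentSelmer,ShaThree}.lean`) is a
complete `√−3`-descent over `ℚ(ζ₃)` carried out on Selmer CLASSES, not only on rational points: the image theorem
`ker [√−3]_* = im [C_·]` for the Mordell `μ₃`-torsors (`MordellCurveThreeDescentImage`, Silverman X.4.2(a) with cubic
Kummer theory / Hilbert 90), the necessity of the local descent conditions for `Ш` (`MordellCurveThreeDescentLocalConverse`,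
Cassels 1964 p. 65 «only if»), the local conditions on the completions (`3 ∣ ord_v` off `330`, at `λ`; the cubic
residue character at `2` extended to `ℚ(ζ₃)_2` by density, `MordellCurveCubicDescentLocalCompletion`), the `K(S,3)` box
of `ℚ(ζ₃)` for `S = {λ,2,5,11}` (`EisensteinFieldSelmer330`: `27` classes `[2^k 5^l 11^m]`, all realised by rational
points), `[√−3]² = −3` ⇒ `Ш(A/ℚ(ζ₃))[3] = 0`, restriction `Ш(A/ℚ)[3] ↪ Ш(A/ℚ(ζ₃))[3]` (`3 ∤ [ℚ(ζ₃):ℚ]`), and the exact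
count `#δ(A'(ℚ(ζ₃))) = 27 = 3^{rank + 1}`.

* §1 the door: `door_at_three_rank_two` (`rank = 2 ∧ t_3 = 0`; `Ш[3^∞] = ⊥` is the tree's `primaryComponent_sha_three`), `selmerCorank_three_eq_rank`,
  `oneFiniteShaComponent_81675` (O for `A`, witness `p₀ = 3`), `exists_door_at_three_rank_two`.
* §2 read through T BY NAME: `shaCorank_81675_eq_zero_of_transfer` (T ⟹ `t_q(A) = 0` ∀ `q`, in particular `t_2(A) = 0`,
  which NO descent in the tree decides for this curve: `A` has no rational `2`-torsion), `selmerCorank_81675_eq_two_of_transfer`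
  (T ⟹ `corank Sel_{q^∞}(A) = 2` ∀ `q`), `transfer_at_door_three` (packaged).

So the route's second instrument («descent at 2 OR 3») is now represented in the kernel, and T's hypothesis is certified
at an odd prime on a rank-2 curve. Nothing here proves T, O or BSD; T remains conjecture-grade at rank ≥ 2 (its
CONCLUSION — e.g. `t_2(A) = 0`, `t_5(A) = 0` — is certified for no curve of rank ≥ 2).
References: H. Cohen, F. Pazuki, Acta Arith. 140 (2009), Thm. 2.1, §5; K. Jeong, Proc. Japan Acad. 95 (2019), §3;
J. W. S. Cassels, J. reine angew. Math. 214/215 (1964), p. 65; J. H. Silverman, *AEC* 2nd ed., X.4; R. Greenberg,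
LNM 1716 (1999), §1.
-/

-- D-0017: single-problem summit, so `Summit.BirchSwinnertonDyer.BirchSwinnertonDyer.…` repeats a namespace BY DESIGN.
set_option linter.dupNamespace false

noncomputable section

namespace Summit.BirchSwinnertonDyer.BirchSwinnertonDyer.Theorems.ShaPrimaryTransferDoorAtThree

open scoped Classical
open Literature.NumberTheory.EllipticCurves Literature.NumberTheory.EllipticCurves.XCubeSub81675
open WeierstrassCurve
open Summit.BirchSwinnertonDyer.BirchSwinnertonDyer.Theses.ShaPrimaryTransfer (FiniteShaComponentTransfer OneFiniteShaComponent)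

/-! ## §1 The door at 3 at rank 2: `A : y² = x³ − 27·55²` -/

/-- `A = mordellCurve (−81675)` is the Weierstrass curve `[0, 0, 0, 0, −81675] : y² = x³ − 81675` (definitionally).
[cite: Jeong2019RankExactlyTwoII, §3] -/
theorem curve_81675_eq : (mordellCurve (-81675 : ℚ)) = (⟨0, 0, 0, 0, -81675⟩ : WeierstrassCurve ℚ) := rfl

/-- **THE DOOR AT 3 AT RANK 2: `rank A(ℚ) = 2` and `t_3(A) = corank_{ℤ₃} Ш(A/ℚ)[3^∞] = 0`** for
`A : y² = x³ − 27·55²` — UNCONDITIONAL (complete `3`-descent over `ℚ(ζ₃)` at the Selmer level; tree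
`XCubeSub81675.mordellWeilRank_curve`, `XCubeSub81675.shaCorank_three`). The first kernel-certified instance of T's
hypothesis at an ODD prime on a curve of rank ≥ 2. [cite: Jeong2019RankExactlyTwoII, Prop. 3.5] [cite: CohenPazuki2009, Thm. 2.1] -/
theorem door_at_three_rank_two :
    (mordellCurve (-81675 : ℚ)).mordellWeilRank = 2 ∧
      (mordellCurve (-81675 : ℚ)).shaCorank 3 = 0 :=
  ⟨mordellWeilRank_curve, shaCorank_three⟩

/-- **`corank_{ℤ₃} Sel_{3^∞}(A/ℚ) = rank A(ℚ) = 2`** — T's hypothesis in Selmer coordinates at `p = 3`.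
[cite: Greenberg1999LNM, §1 pp. 54–57] -/
theorem selmerCorank_three_eq_rank :
    (mordellCurve (-81675 : ℚ)).selmerCorank 3 = 2 ∧
      (mordellCurve (-81675 : ℚ)).selmerCorank 3 =
        (mordellCurve (-81675 : ℚ)).mordellWeilRank :=
  ⟨selmerCorank_three, by rw [selmerCorank_three, mordellWeilRank_curve]⟩

/-- **O holds for `A`** (rank 2), with witness the ODD prime `p₀ = 3` (an instance of the crux `OneFiniteShaComponent`,
stmt-22357, decided by `3`-descent). UNCONDITIONAL. [cite: CohenPazuki2009, Thm. 2.1] -/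
theorem oneFiniteShaComponent_81675 :
    ∃ (p : ℕ) (_ : Fact p.Prime), (mordellCurve (-81675 : ℚ)).shaCorank p = 0 :=
  ⟨3, ⟨Nat.prime_three⟩, shaCorank_three⟩

/-- **Existence form**: there is an elliptic curve over `ℚ` of Mordell–Weil rank `2` whose door at `3` is open —
`t_3 = 0`, `Ш[3^∞] = 0`, `corank Sel_{3^∞} = 2` — certified by descent at `3` alone.
[cite: Jeong2019RankExactlyTwoII, Prop. 3.5] -/
theorem exists_door_at_three_rank_two :
    ∃ W : WeierstrassCurve ℚ, W.IsElliptic ∧ W.mordellWeilRank = 2 ∧ W.shaCorank 3 = 0 ∧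
      AddCommGroup.primaryComponent W.sha 3 = ⊥ ∧ W.selmerCorank 3 = 2 :=
  ⟨mordellCurve (-81675 : ℚ), isElliptic_curve, mordellWeilRank_curve, shaCorank_three, primaryComponent_sha_three,
    selmerCorank_three⟩

/-! ## §2 The door read through T (the crux BY NAME) -/

/-- **T at the door at 3**: granting T, `t_q(A) = 0` at EVERY prime `q` — in particular `t_2(A) = 0`, which no
instrument in the tree decides for `A` (no rational `2`-torsion: `x³ = 81675` has no rational root), and `t_5(A) = 0`,
`t_{11}(A) = 0` at the primes of additive reduction. (Uses the crux BY NAME; unconditional at `q = 3`.)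
[cite: CohenPazuki2009, Thm. 2.1] -/
theorem shaCorank_81675_eq_zero_of_transfer (hT : FiniteShaComponentTransfer) (q : ℕ) [Fact q.Prime] :
    (mordellCurve (-81675 : ℚ)).shaCorank q = 0 :=
  haveI := isElliptic_curve
  haveI : Fact (Nat.Prime 3) := ⟨Nat.prime_three⟩
  hT _ 3 q shaCorank_three

/-- **T ⟹ `corank_{ℤ_q} Sel_{q^∞}(A/ℚ) = 2` at every prime `q`** (Greenberg's identity
`corank Sel_{q^∞} = rank + t_q`, tree theorem `selmerCorank_eq_mordellWeilRank_add_holds`).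
[cite: Greenberg1999LNM, §1 pp. 54–57] -/
theorem selmerCorank_81675_eq_two_of_transfer (hT : FiniteShaComponentTransfer) (q : ℕ) [Fact q.Prime] :
    (mordellCurve (-81675 : ℚ)).selmerCorank q = 2 := by
  haveI := isElliptic_curve
  rw [(mordellCurve (-81675 : ℚ)).selmerCorank_eq_mordellWeilRank_add_holds q, mordellWeilRank_curve,
    shaCorank_81675_eq_zero_of_transfer hT q]

/-- **The transfer cell `(A, 3, q)` packaged**: T's hypothesis holds at `p = 3` unconditionally; T's conclusion at
any other prime `q` is exactly what T asserts and nothing in the tree certifies — the first cross-prime cell of T whose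
door prime is odd. [cite: CohenPazuki2009, Thm. 2.1] -/
theorem transfer_at_door_three :
    (mordellCurve (-81675 : ℚ)).shaCorank 3 = 0 ∧
      (FiniteShaComponentTransfer → ∀ (q : ℕ) [Fact q.Prime],
        (mordellCurve (-81675 : ℚ)).shaCorank q = 0 ∧
          (mordellCurve (-81675 : ℚ)).selmerCorank q = 2) :=
  ⟨shaCorank_three, fun hT q _ => ⟨shaCorank_81675_eq_zero_of_transfer hT q, selmerCorank_81675_eq_two_of_transfer hT q⟩⟩

end Summit.BirchSwinnertonDyer.BirchSwinnertonDyer.Theorems.ShaPrimaryTransferDoorAtThree
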